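import Mathlib.AlgebraicGeometry.Noetherian
import Mathlib.AlgebraicGeometry.Morphisms.QuasiCompact
import Literature.AlgebraicGeometry.Motives.SubschemeCyclesFundamentalProofs
import HarnessLib

/-!
# Flat pull-back of cycles has locally finite support: proof (trunk MotiveL, prelude C1)

`Literature.AlgebraicGeometry.Motives.SubschemeCycles` records as a named fact
`Literature.AlgebraicGeometry.Motives.locallyFinsupp_flatPullbackFun`: for a morphism `f : X ⟶ Y` locally of finite type and a
cycle `c ∈ Z_* Y`, the coefficient function of the pull-back `f^* c`,
`x ↦ c (f x) · ℓ(𝒪_{X_{f x}, x})` (the length taken to be `0` when infinite), has locally finite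
support. This file discharges it (`Literature.AlgebraicGeometry.Motives.locallyFinsupp_flatPullbackFun_holds`).

This is the local finiteness half of the Stacks Project's definition of flat pull-back
(Tag 02RB: "`f^* α = ∑ nᵢ f^*[Zᵢ]` […] The sum is locally finite by Lemma 02R9"), which rests on
two printed lemmas:

* Tag 02R9: "Let `X`, `Y` be locally of finite type over `S`. Let `f : X → Y` be a morphism.
  Assume `{Zᵢ}` is a locally finite collection of closed subsets of `Y`. Then `{f⁻¹(Zᵢ)}` is a
  locally finite collection of closed subsets of `X`." (Proof: for `U ⊂ X` quasi-compact open
  with `f(U) ⊂ V` quasi-compact open, `{i | f⁻¹(Zᵢ) ∩ U ≠ ∅} ⊂ {i | Zᵢ ∩ V ≠ ∅}`.)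
* Tag 0BE1: "Let `X` be a locally Noetherian scheme. Let `Z ⊂ X` be a closed subscheme. The
  collection of irreducible components of `Z` is locally finite in `X`." (Proof: a quasi-compact
  open `U ⊂ X` is a Noetherian scheme, hence a Noetherian topological space, so has finitely
  many irreducible components), together with Tag 02QT (1): at the generic point `ξ` of an
  irreducible component the local ring `𝒪_{Z,ξ}` has finite length.

Flatness plays no role in the local finiteness (as in Tag 02R9), and neither does a base `S`:
the fibres `X_y` of a morphism locally of finite type are locally of finite type over `κ(y)`,
hence locally Noetherian, which is all that is used.

## Proof

Fix `x ∈ X`. Choose an open `V ∋ f x` meeting `supp c` in finitely many points and an affine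
open `x ∈ U ⊆ f⁻¹ V`. If `x' ∈ U` lies in the support of `f^* c`, then `y = f x' ∈ V ∩ supp c`
and `ℓ(𝒪_{X_y, x'}) < ∞`, so `x'` is maximal for the specialisation order of the fibre `X_y`
(`Literature.AlgebraicGeometry.Motives.isMax_of_isGenericComponentPoint`: an Artinian local ring has one prime), and it lies in
the open `U ∩ X_y` of `X_y`, which is quasi-compact because `X_y → X` is quasi-compact (a base
change of `Spec κ(y) → Y`). By Tag 0BE1 in the form `Literature.AlgebraicGeometry.Motives.finite_setOf_mem_and_isMax` (the
maximal points lying in a quasi-compact open `O` of a locally Noetherian scheme are finitely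
many: they are generic points of irreducible components of the Noetherian scheme `O`), each
`y ∈ V ∩ supp c` contributes finitely many such `x'`.

## References

* The Stacks Project, Tag 02R9 (inverse image of a locally finite collection), Tag 02RB
  (definition of flat pull-back), Tag 02QT (multiplicities are finite), Tag 0BE1 (irreducible
  components of a locally Noetherian scheme are locally finite), Tag 0BA8. [StacksProject]
* W. Fulton, *Intersection Theory*, 2nd ed., Springer (1998), §1.5, §1.7. [Fulton1998]
-/

universe u

open CategoryTheory AlgebraicGeometry Limits Topology TopologicalSpace

namespace Literature.AlgebraicGeometry.Motives

/-! ### Maximal points in a quasi-compact open of a locally Noetherian scheme -/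

section MaximalPoints

variable {W : Scheme.{u}}

/-- In a scheme, a point maximal for the specialisation order (`a ≤ b ↔ b ⤳ a`) is the generic
point of an irreducible component: the irreducible component containing `w` is the closure of
its generic point `η`, so `η ⤳ w`, whence `η = w` by maximality (schemes are sober and `T₀`).
[folklore] -/
theorem mem_genericPoints_of_isMax {w : W} (hw : IsMax w) : w ∈ genericPoints W := by
  have hC : IsIrreducible (irreducibleComponent w) := isIrreducible_irreducibleComponent
  have hgen : IsGenericPoint hC.genericPoint (irreducibleComponent w) :=
    hC.isGenericPoint_genericPoint isClosed_irreducibleComponent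
  have h1 : hC.genericPoint ⤳ w := hgen.specializes mem_irreducibleComponent
  have h2 : w ⤳ hC.genericPoint :=
    Scheme.le_iff_specializes.mp (hw (Scheme.le_iff_specializes.mpr h1))
  have heq : hC.genericPoint = w := (h1.antisymm h2).eq
  change closure {w} ∈ irreducibleComponents W
  rw [← heq, hgen.def]
  exact irreducibleComponent_mem_irreducibleComponents w

/-- A point of an open subscheme `O ⊆ W` whose image in `W` is maximal for the specialisation
order is maximal in `O` (the open immersion `O ⟶ W` is an embedding, so reflects
specialisations). [folklore] -/
theorem isMax_of_isMax_ι (O : W.Opens) {w : (O : Scheme.{u})} (hw : IsMax (O.ι w)) :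
    IsMax w := by
  intro b hb
  have hb' : O.ι b ⤳ O.ι w := (Scheme.le_iff_specializes.mp hb).map O.ι.continuous
  have h : O.ι w ⤳ O.ι b := Scheme.le_iff_specializes.mp (hw (Scheme.le_iff_specializes.mpr hb'))
  exact Scheme.le_iff_specializes.mpr (O.ι.isEmbedding.isInducing.specializes_iff.mp h)

/-- **Stacks Project, Tag 0BE1** (irreducible components of a locally Noetherian scheme are
locally finite), pointwise form: in a locally Noetherian scheme `W`, only finitely many points
of a quasi-compact open `O` are maximal for the specialisation order (i.e. are generic points
of irreducible components of `W`). Indeed `O` is a Noetherian scheme, hence a Noetherian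
topological space with finitely many irreducible components (Tag 0BA8), and a maximal point
lying in `O` is the generic point of one of them. [cite: StacksProject, Tag 0BE1] -/
theorem finite_setOf_mem_and_isMax [IsLocallyNoetherian W] (O : W.Opens)
    (hO : IsCompact (O : Set W)) : {w : W | w ∈ O ∧ IsMax w}.Finite := by
  haveI : CompactSpace (O : Scheme.{u}) := isCompact_iff_compactSpace.mp hO
  haveI : IsNoetherian (O : Scheme.{u}) := { }
  have hfin : (genericPoints (O : Scheme.{u})).Finite :=
    genericPoints.finite (finite_irreducibleComponents_of_isNoetherian (X := (O : Scheme.{u})))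
  refine (hfin.image O.ι).subset ?_
  rintro w ⟨hwO, hw⟩
  exact ⟨⟨w, hwO⟩, mem_genericPoints_of_isMax (isMax_of_isMax_ι O (w := ⟨w, hwO⟩) hw), rfl⟩

end MaximalPoints

/-! ### Fibres of a morphism locally of finite type -/

section Fiber

variable {X Y : Scheme.{u}} (f : X ⟶ Y) (y : Y)

/-- The scheme-theoretic fibre `X_y = X ×_Y Spec κ(y)` of a morphism locally of finite type is
locally Noetherian (it is locally of finite type over the field `κ(y)`; Stacks Tag 01T6).
Stated as a theorem (a `Prop`-valued class), used via `haveI`. [folklore] -/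
theorem isLocallyNoetherian_fiber [LocallyOfFiniteType f] : IsLocallyNoetherian (f.fiber y) := by
  delta Scheme.Hom.fiber
  infer_instance

/-- The inclusion `X_y ⟶ X` of a scheme-theoretic fibre is quasi-compact: it is the base change
of `Spec κ(y) ⟶ Y`, whose source is a Noetherian (one-point) space. Stated as a theorem,
used via `haveI`. [folklore] -/
theorem quasiCompact_fiberι : QuasiCompact (f.fiberι y) := by
  delta Scheme.Hom.fiberι Scheme.Hom.fiber
  infer_instance

end Fiber

/-! ### Local finiteness of the support of `f^* c` -/

section FlatPullback

variable {X Y : Scheme.{u}}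

/-- A point in the support of the coefficient function of `f^* c` lies over the support of `c`
and is a generic component point of its fibre (its local ring in `X_{f x}` has finite, nonzero
length). [folklore] -/
theorem isGenericComponentPoint_of_mem_support_flatPullbackFun (f : X ⟶ Y)
    (c : AlgebraicCycle Y ℤ) {x : X} (hx : x ∈ Function.support (f.flatPullbackFun c)) :
    f x ∈ Function.support c ∧ IsGenericComponentPoint (f.fiber (f x)) (f.asFiber x) := by
  refine ⟨fun h ↦ hx ?_, ?_⟩
  · simp [Scheme.Hom.flatPullbackFun, h]
  · by_contra h
    exact hx (by simp [Scheme.Hom.flatPullbackFun,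
      stalkLength_eq_zero_of_not_isGenericComponentPoint h])

/-- **Stacks Project, Tags 02R9 and 02RB: the flat pull-back `f^* α = ∑ nᵢ f^*[Zᵢ]` is a
locally finite sum.** Discharge of the named fact `Literature.AlgebraicGeometry.Motives.locallyFinsupp_flatPullbackFun`: for
`f : X ⟶ Y` locally of finite type and `c ∈ Z_* Y`, the coefficient function
`x ↦ c (f x) · ℓ(𝒪_{X_{f x}, x})` of `f^* c` has locally finite support. Over an open `V ∋ f x`
meeting `supp c` in finitely many points `yᵢ` (Tag 02R9), an affine open `x ∈ U ⊆ f⁻¹ V` meets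
the support only in maximal points of the fibres `X_{yᵢ}` lying in the quasi-compact opens
`U ∩ X_{yᵢ}` of these locally Noetherian schemes, finitely many by Tag 0BE1
(`Literature.AlgebraicGeometry.Motives.finite_setOf_mem_and_isMax`). [cite: StacksProject, Tag 02R9] -/
theorem locallyFinsupp_flatPullbackFun_holds : locallyFinsupp_flatPullbackFun.{u} := by
  intro X Y f _ c x
  obtain ⟨V, hV, hVfin⟩ := c.locallyFiniteSupport (f x)
  obtain ⟨V', hV'V, hV'open, hxV'⟩ := mem_nhds_iff.mp hV
  obtain ⟨U, hU, hxU, hUV⟩ :=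
    exists_isAffineOpen_mem_and_subset (X := X) (x := x) (U := f ⁻¹ᵁ ⟨V', hV'open⟩) hxV'
  refine ⟨U, U.2.mem_nhds hxU, ?_⟩
  have hfinY : (V' ∩ Function.support c).Finite :=
    hVfin.subset (Set.inter_subset_inter_left _ hV'V)
  refine (hfinY.biUnion (t := fun y ↦ (f.fiberι y) ''
      {w : ↥(f.fiber y) | w ∈ f.fiberι y ⁻¹ᵁ U ∧ IsMax w}) fun y _ ↦ ?_).subset ?_
  · haveI := isLocallyNoetherian_fiber f y
    haveI := quasiCompact_fiberι f y
    exact (finite_setOf_mem_and_isMax (f.fiberι y ⁻¹ᵁ U)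
      ((f.fiberι y).isCompact_preimage hU.isCompact)).image _
  · rintro x' ⟨hx'U, hx'⟩
    obtain ⟨hc, hgen⟩ := isGenericComponentPoint_of_mem_support_flatPullbackFun f c hx'
    refine Set.mem_biUnion (x := f x') ⟨hUV hx'U, hc⟩ ⟨f.asFiber x', ⟨?_, ?_⟩, ?_⟩
    · change f.fiberι (f x') (f.asFiber x') ∈ (U : Set X)
      rw [Scheme.Hom.fiberι_asFiber]
      exact hx'U
    · exact isMax_of_isGenericComponentPoint hgen
    · exact Scheme.Hom.fiberι_asFiber f x'

end FlatPullback

end Literature.AlgebraicGeometry.Motives
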